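import Literature.AnabelianGeometry.EtaleTheta.Discharge.Sec3ConstantLineOfRlfZ
import Literature.AnabelianGeometry.EtaleTheta.Discharge.Sec3ConstantLineOfRlfWeak
import Literature.AnabelianGeometry.EtaleTheta.Discharge.Sec3Prop34iiOfGaloisCovering
import Literature.AnabelianGeometry.EtaleTheta.Discharge.Sec3Prop34iConnectedOfGaloisCovering
import Literature.AnabelianGeometry.EtaleTheta.Discharge.Sec3Cor38iiOfRatSupport
import Literature.AnabelianGeometry.EtaleTheta.TemperedFrobenioidOfGaloisCoveringOneComponent

/-!
# [EtTh] Prop. 3.4 (ii) — the cone node `EtTh:Prop3.4(ii)` RE-CLOSED: its two flagged closing theorems with the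
# refuted-closure FACT binders (F-2490 · F-2341 · F-2808 · F-1026 · F-0581) DERIVED from closed producers, not bound

S. Mochizuki, *The étale theta function and its Frobenioid-theoretic manifestations*, Publ. RIMS **45** (2009)
[MochizukiEtTh2009], §3: Prop. 3.4 (ii) PRIMS PDF p.74 ("Suppose that `Y^log → X^log` is a connected tempered covering
… geometrically connected over `L`.  Then we have natural isomorphisms of monoids `O_L^× ⥲ Ker(B₀(Y^log) →
Φ₀^gp(Y^log))`; `O_L^▷ ⥲ B₀(Y^log) ×_{Φ₀^gp(Y^log)} Φ₀(Y^log)`; `L^× ⥲ F₀(Y^log)`"), proof p.75 l.10–11 ("Assertion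
(ii) follows immediately from Proposition 3.2, (ii)") [cite: MochizukiEtTh2009, Prop 3.4 p.74]; Def. 3.6 (i)/(ii)
pp.76–77; Cor. 3.8 (ii) pp.80–82 [cite: MochizukiEtTh2009, Cor 3.8 p.81].

abc-iut cell, layer L2, block C / W6, seat abc-iut-w6-d058 (gen 4; R-C stale-holder re-arm W9 (i) of THIS node; gens 2–3
of this lineage proved Prop. 3.4 (ii) at the constructed Def. 3.3 (iii) data: `Sec3Prop34iiOfGaloisCovering` p437192,
`Sec3Prop34iConnectedOfGaloisCovering` p438397, `Sec3Def36iOfGaloisCovering` p439158, in print's vocabulary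
`Sec3Prop34iiConstField` p451489).  PROOF-ONLY (0 definitions, no instance, no new Prop fact).

WHY THIS FILE (plan C-R33 / letter K4, abc-iut-c312-2 `CONE-K4-RECLOSE.tsv` v4 row 40, class RECLOSABLE).  The kernel
index `Summit.ABC.IUTFork.DAG.N_EtTh_Prop3_4_ii'` conjoins six landed theorems; two of them BIND a FACT-LIST row whose
universal closure is refuted (so that, as typed, the theorem could be vacuous at data violating the row):
* `RealifiedDivisorMonoids.ofRlfZ_mem_FΛ_of_divΛ_eq_of` (abc-iut-w4-d008, p428972) binds `h34 : dm.Prop34 V V₀`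
  (F-2490, `DivisorMonoids.not_forall_prop34`) — but USES only its Prop. 3.4 (ii) clause `mem_F₀_of_div₀_mem`
  (isomorphism 2: "effective log-divisor ⇒ constant");
* `Cor38Hyp.cor38_ii_of_inputs` (abc-iut-w6-d040, p431051) binds `hvoc_i` (heads F-2341 `IsDivSlim`), `H` (F-2808
  `StandardIsotropicNotGroupLike`), `h411`/`h411'` (F-1026 `Cor411ii`), `hR_i` (F-0581 `Remark363`).
Here both are RE-CLOSED against the surviving instance forms, every input BY NAME from its landed CLOSED producer:

§1 `ofRlfZ_mem_FΛ_of_divΛ_eq_of_iso₂` / `ofRlfZWeak_mem_FΛ_of_divΛ_eq_of_iso₂` — the same conclusions over the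
   constructed Def. 3.6 (i) data of monoid type `ℤ` (strong `ofRlfZ`, and the weak data of record `ofRlfZWeak`) with
   the `Prop34` binder replaced by THE ONE PRINTED CLAUSE the proof uses (Prop. 3.4 (ii), isomorphism 2, on the
   Def. 3.3 (iii) data `(Φ₀, B₀, div₀, F₀)`).
§2 NO-`Prop34` INSTANCES at the constructed Def. 3.3 (iii) data of the coverings dominated by one universal
   combinatorial covering (`DivisorMonoids.ofGaloisAction A hZ`, all `G`-sets; `ofGaloisActionConnected A hZ`, the
   connected ones = print's `D₀`), where isomorphism 2 is a THEOREM from Prop. 3.2 (ii) (`prop34_mem_F₀_of_div₀_mem`,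
   `mem_fZero_of_divZeroHom_eq_of`): the original closers fed with the CLOSED producers `prop34_ofGaloisAction_top` /
   `prop34_ofGaloisActionConnected` — over the weak data (all `G`-sets) with NO binder beyond the interface `(Z, A)`
   and the cusp laws `hZ` (GAP G-w6d058-1); over the strong data modulo the vocabulary predicate `hpf` ([FrdI] Def. 2.4
   (i) as printed, F-2377 class predicate — it holds iff every `Φ₀(Y)` has finitely many prime orbits, cell finding
   F-L2d2-1; it fails at the Tate tower's universal level, where the weak data are the data of record), and with NO
   binder at all at abc-iut-w6-d048's one-component model of record `OneCompFrd.T` (`hP34Λ_T`, `hpf := hpf_oneComp`).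
   (Over the weak connected data of record the instance is abc-iut-L2-d2's `hP34Λ_ofGaloisActionConnected_weak`,
   already in the tree — cited, not restated.)
§3 `Cor38Hyp.cor38_ii_of_inputs_reclosed` — THE flagged Cor. 3.8 (ii) knit itself, instantiated at the canonical
   vocabularies (`treeMonoidVocab`, `treeCatVocab`) with: `IsDivSlim` := [FrdI] Def. 4.5 (iv) read on `(E, Φ)`
   (bridge `⟨·⟩`, so `hvoc_i` disappear — abc-iut-w5-d124's instantiation); `H` := abc-iut-w5-d135's
   `standardIsotropicNotGroupLike_treeCatVocab` (C38-L01 from Thm. 3.7 (i)(ii)); `h411`, `h411'` := abc-iut-w6-d040's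
   `cor411ii_of_fact_treeCatVocab` / `…_symm_…` (from [FrdI] Thm. 3.4 (ii) = F-0711 PROVED, `FrdI.Thm34ii_holds`);
   `hR_i` := abc-iut-w5-d135's `remark363_of_isSharp` (from `hP34Λ_i` + `hFinv_i`); `hO_i` :=
   `hullEssImageObjClause_holds`; `h34` := `FrdI.Thm34ii_holds`.  Remaining inputs per side, all NAMED print-level
   clauses and none a FACT-LIST row: `hBmon_i` ("`𝔹_i` is a monoid on `D_i`", [FrdI] Thm. 5.2 preamble; ⟸ `hBinj`,
   `hFSM` by abc-iut-L2-t3's `isMonoidOn_ratFnFunctor`), `hP34Λ_i` (Prop. 3.4 (ii) at monoid type `Λ`, GAP G-w5d124-1),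
   `hFinv_i` (Prop. 3.4 (ii) iso 3: `F₀^Λ(Y)` inverse-closed, G-w5d135-1), `hNZ_i` (Def. 3.6 (ii)(b) bracket,
   G-w5d124-2), `hSup_i` (suprema along `ℝ·Φ₀^cnst`, G-w5d124-3).  (abc-iut-w6-d040's `cor38_ii_canonical_of_structural`
   / `_of_ratSupport_of_hFinv`, p437110, are the siblings on the `hZQ`/`hsat` route to C38-L05; this one keeps
   `cor38_ii_of_inputs`' own `hSup` route.)
Instance currency for §3 already in the tree (abc-iut-L2-d2 p449948 `Sec3Cor38OfRankOnePoint`): `Cor38_ii` with NO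
binder beyond `h` at the tempered Frobenioid of every rank-one point of the constructed connected data, and at the
model of record `TateTowerFrd.temperedFrobenioid`.

HONEST FRAMING: refereed pre-IUT material ([EtTh] §3 over [FrdI] §§2–5); compositions of landed theorems, nothing
re-typed, no statement of print strengthened; a refuted-closure binder makes a theorem vacuous-as-typed at bad data,
not wrong — here it is no longer a binder.  Nothing here bears on [IUTchIII] Cor. 3.12; no side is taken; typed ≠
proved for anything not stated here.
-/

noncomputable section

namespace Literature.AnabelianGeometry.EtaleTheta

open CategoryTheory Opposite Literature.AlgebraicGeometry.Frobenioids

universe u₀ v₀ u v w u₁ v₁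

/-! ## §1 The F-2490 site: `Prop34` replaced by Prop. 3.4 (ii), isomorphism 2, on the Def. 3.3 (iii) data -/

namespace RealifiedDivisorMonoids

variable {D₀ : Type u} [Category.{v} D₀] (dm : DivisorMonoids.{u, v, w} D₀)

/-- **Prop. 3.4 (ii), isomorphism 2, lifted to the constructed Def. 3.6 (i) data of monoid type `ℤ`** (`ofRlfZ dm hpf`:
`B₀^ℤ = B₀`, `F₀^ℤ = F₀`, `Φ₀^ℝ = Φ₀^rlf`) — the re-close sibling of `ofRlfZ_mem_FΛ_of_divΛ_eq_of` binding, instead of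
the typed structure `dm.Prop34 V V₀` (F-2490), exactly the clause of it that the proof uses: "a log-meromorphic function
whose log-divisor is effective is constant" (`O_L^▷ ≅ B₀ ×_{Φ₀^gp} Φ₀ ⊆ F₀`).  An element of `B₀(Y)` whose divisor becomes
effective in `(Φ₀^rlf)^gp(Y)` is already effective in `Φ₀^gp(Y)` (`RlfEffective.exists_eq_of`), hence constant.
[cite: MochizukiEtTh2009, Prop 3.4 p.74] -/
theorem ofRlfZ_mem_FΛ_of_divΛ_eq_of_iso₂ (hpf : ∀ Y : D₀ᵒᵖ, IsPerfFactorial (dm.Φ₀.obj Y))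
    (hP34ii : ∀ (Y : D₀ᵒᵖ) (b : dm.B₀.obj Y) (x : dm.Φ₀.obj Y),
      dm.div₀ Y b = Algebra.GrothendieckGroup.of x → b ∈ dm.F₀ Y)
    (Y : D₀ᵒᵖ) (b : (ofRlfZ dm hpf).BΛ.obj Y) (x : (ofRlfZ dm hpf).ΦR.obj Y)
    (hbx : (ofRlfZ dm hpf).divΛ Y b = Algebra.GrothendieckGroup.of x) : b ∈ (ofRlfZ dm hpf).FΛ Y := by
  obtain ⟨x₀, hx₀, -⟩ := RlfEffective.exists_eq_of (hpf Y) (dm.div₀ Y b) x hbx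
  exact hP34ii Y b x₀ hx₀

/-- **The same over the WEAK Def. 3.6 (i) data of record** `ofRlfZWeak dm hpf` (`Φ₀(Y)` weakly perf-factorial with
cofinal perfection — the reading of record of Prop. 3.4 (i), cell finding F-L2d2-1): the re-close sibling of
`ofRlfZWeak_mem_FΛ_of_divΛ_eq_of` with the `Prop34` binder replaced by Prop. 3.4 (ii), isomorphism 2.
[cite: MochizukiEtTh2009, Prop 3.4 p.74] -/
theorem ofRlfZWeak_mem_FΛ_of_divΛ_eq_of_iso₂ (hpf : ∀ Y : D₀ᵒᵖ, IsPerfFactorialCof (dm.Φ₀.obj Y))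
    (hP34ii : ∀ (Y : D₀ᵒᵖ) (b : dm.B₀.obj Y) (x : dm.Φ₀.obj Y),
      dm.div₀ Y b = Algebra.GrothendieckGroup.of x → b ∈ dm.F₀ Y)
    (Y : D₀ᵒᵖ) (b : (ofRlfZWeak dm hpf).BΛ.obj Y) (x : (ofRlfZWeak dm hpf).ΦR.obj Y)
    (hbx : (ofRlfZWeak dm hpf).divΛ Y b = Algebra.GrothendieckGroup.of x) : b ∈ (ofRlfZWeak dm hpf).FΛ Y := by
  obtain ⟨x₀, hx₀, -⟩ := RlfEffective.exists_eq_of_weak (hpf Y).weak (dm.div₀ Y b) x hbx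
  exact hP34ii Y b x₀ hx₀

/-- The flagged closer IS the `iso₂` sibling fed with the clause `Prop34.mem_F₀_of_div₀_mem` of the typed structure (so
nothing of abc-iut-w4-d008's theorem is lost by the re-keying). [cite: MochizukiEtTh2009, Prop 3.4 p.74] -/
theorem ofRlfZ_mem_FΛ_of_divΛ_eq_of_eq_iso₂ (hpf : ∀ Y : D₀ᵒᵖ, IsPerfFactorial (dm.Φ₀.obj Y))
    {V : FrdIMonoidStub.{w}} {V₀ : FrdICatStub.{u, v, w} D₀} (h34 : dm.Prop34 V V₀) :
    ofRlfZ_mem_FΛ_of_divΛ_eq_of dm hpf h34 =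
      ofRlfZ_mem_FΛ_of_divΛ_eq_of_iso₂ dm hpf h34.mem_F₀_of_div₀_mem := rfl

end RealifiedDivisorMonoids

/-! ## §2 The F-2490 site at the CONSTRUCTED Def. 3.3 (iii) data: the closers fed with the closed producers -/

namespace DivisorMonoids

open LogDivisorModel.GaloisAction

variable {Z : LogDivisorModel.{u}} {G : Type u} [Group G] (A : Z.GaloisAction G) (hZ : Z.CuspLaws)

/-- **At the Def. 3.3 (iii) data of ALL coverings dominated by `Z^log_∞`** (`ofGaloisAction A hZ`), strong Def. 3.6 (i)
data: abc-iut-w4-d008's closer with its F-2490 binder SUPPLIED by the closed producer `prop34_ofGaloisAction_top`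
(Prop. 3.4 holds outright there at the content-isolating vocabularies; its (ii)-clauses are theorems from Prop. 3.2
(ii)).  Remaining binder: the vocabulary predicate `hpf` ("`Φ₀(Y)` perf-factorial as printed", [FrdI] Def. 2.4 (i)).
[cite: MochizukiEtTh2009, Prop 3.4 p.74] -/
theorem ofRlfZ_mem_FΛ_of_divΛ_eq_of_ofGaloisAction
    (hpf : ∀ Y : (Action (Type u) G)ᵒᵖ, IsPerfFactorial ((ofGaloisAction A hZ).Φ₀.obj Y))
    (Y : (Action (Type u) G)ᵒᵖ) (b : (RealifiedDivisorMonoids.ofRlfZ (ofGaloisAction A hZ) hpf).BΛ.obj Y)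
    (x : (RealifiedDivisorMonoids.ofRlfZ (ofGaloisAction A hZ) hpf).ΦR.obj Y)
    (hbx : (RealifiedDivisorMonoids.ofRlfZ (ofGaloisAction A hZ) hpf).divΛ Y b = Algebra.GrothendieckGroup.of x) :
    b ∈ (RealifiedDivisorMonoids.ofRlfZ (ofGaloisAction A hZ) hpf).FΛ Y :=
  RealifiedDivisorMonoids.ofRlfZ_mem_FΛ_of_divΛ_eq_of (ofGaloisAction A hZ) hpf (prop34_ofGaloisAction_top A hZ)
    Y b x hbx

/-- **The same over the weak Def. 3.6 (i) data, NO binder beyond `(Z, A, hZ)`**: `Φ₀(Y)` is weakly perf-factorial with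
cofinal perfection for EVERY `G`-set `Y` (abc-iut-w6-d057's `isPerfFactorialCof_phiZero`), and isomorphism 2 is a theorem there.
[cite: MochizukiEtTh2009, Prop 3.4 p.74] -/
theorem ofRlfZWeak_mem_FΛ_of_divΛ_eq_of_ofGaloisAction
    (Y : (Action (Type u) G)ᵒᵖ)
    (b : (RealifiedDivisorMonoids.ofRlfZWeak (ofGaloisAction A hZ) (fun Y => isPerfFactorialCof_phiZero A Y.unop)).BΛ.obj Y)
    (x : (RealifiedDivisorMonoids.ofRlfZWeak (ofGaloisAction A hZ) (fun Y => isPerfFactorialCof_phiZero A Y.unop)).ΦR.obj Y)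
    (hbx : (RealifiedDivisorMonoids.ofRlfZWeak (ofGaloisAction A hZ) (fun Y => isPerfFactorialCof_phiZero A Y.unop)).divΛ Y b =
      Algebra.GrothendieckGroup.of x) :
    b ∈ (RealifiedDivisorMonoids.ofRlfZWeak (ofGaloisAction A hZ) (fun Y => isPerfFactorialCof_phiZero A Y.unop)).FΛ Y :=
  RealifiedDivisorMonoids.ofRlfZWeak_mem_FΛ_of_divΛ_eq_of (ofGaloisAction A hZ) _ (prop34_ofGaloisAction_top A hZ)
    Y b x hbx

/-- **At the Def. 3.3 (iii) data of the CONNECTED coverings** (`ofGaloisActionConnected A hZ`, print's `D₀`), strong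
Def. 3.6 (i) data: the closer with its F-2490 binder SUPPLIED by the closed producer `prop34_ofGaloisActionConnected`
(this lineage, gen 2: Prop. 3.4 (i) in the weak reading of record and (ii), at the tree's vocabularies).  Remaining
binder: the printed-strength vocabulary predicate `hpf` (true iff every `Φ₀(Y)` has finitely many prime orbits).
[cite: MochizukiEtTh2009, Prop 3.4 p.74] -/
theorem ofRlfZ_mem_FΛ_of_divΛ_eq_of_ofGaloisActionConnected
    (hpf : ∀ Y : ((isConnectedGSet (G := G)).FullSubcategory)ᵒᵖ,
      IsPerfFactorial ((ofGaloisActionConnected A hZ).Φ₀.obj Y))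
    (Y : ((isConnectedGSet (G := G)).FullSubcategory)ᵒᵖ)
    (b : (RealifiedDivisorMonoids.ofRlfZ (ofGaloisActionConnected A hZ) hpf).BΛ.obj Y)
    (x : (RealifiedDivisorMonoids.ofRlfZ (ofGaloisActionConnected A hZ) hpf).ΦR.obj Y)
    (hbx : (RealifiedDivisorMonoids.ofRlfZ (ofGaloisActionConnected A hZ) hpf).divΛ Y b =
      Algebra.GrothendieckGroup.of x) :
    b ∈ (RealifiedDivisorMonoids.ofRlfZ (ofGaloisActionConnected A hZ) hpf).FΛ Y :=
  RealifiedDivisorMonoids.ofRlfZ_mem_FΛ_of_divΛ_eq_of (ofGaloisActionConnected A hZ) hpf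
    (prop34_ofGaloisActionConnected A hZ (fun _ => True) (fun _ => True)) Y b x hbx

end DivisorMonoids

/-! Over the WEAK Def. 3.6 (i) data of record of the connected coverings (`ofRlfZWeak (ofGaloisActionConnected A hZ) hpf`,
the data of abc-iut-w6-d048's rank-one points and of abc-iut-L2-d2's `TateTowerFrd`) the corresponding NO-`Prop34`
instance is ALREADY in the tree: abc-iut-L2-d2's `TemperedFrobenioid.hP34Λ_ofGaloisActionConnected_weak`
(`Discharge/Sec3Cor38OfGaloisCoveringConnected.lean`) and this lineage's `DivisorMonoids.hP34Λ_rlfZ_ofGaloisActionConnected`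
(p439158) — not restated here. -/

namespace OneCompFrd

open LogDivisorModel LogDivisorModel.GaloisAction

variable (U : Type) [CommGroup U] (hU : ∀ u : U, (∀ N : ℕ+, ∃ g : U, g ^ (N : ℕ) = u) → u = 1)

/-- **NO binder at all at the one-component model of record** (abc-iut-w6-d048's `OneCompFrd`: smooth reduction,
`Gal(Z_∞/X) = 1`, constants `L^× = U × ℤ`; its Def. 3.6 (i) data `OneCompFrd.T U hU` ARE the strong `ofRlfZ` data, the
printed perf-factorial slot being the theorem `hpf_oneComp`): Prop. 3.4 (ii), isomorphism 2, at monoid type `ℤ` — an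
element of `B₀^ℤ(Y)` whose `Λ`-divisor is effective is a constant. [cite: MochizukiEtTh2009, Prop 3.4 p.74] -/
theorem hP34Λ_T (Y : D₀ᵒᵖ) (b : (T U hU).BΛ.obj Y) (x : (T U hU).ΦR.obj Y)
    (hbx : (T U hU).divΛ Y b = Algebra.GrothendieckGroup.of x) : b ∈ (T U hU).FΛ Y :=
  DivisorMonoids.ofRlfZ_mem_FΛ_of_divΛ_eq_of_ofGaloisActionConnected (act U hU) (cuspLaws_oneComp U hU)
    (hpf_oneComp U hU) Y b x hbx

end OneCompFrd

/-! ## §3 The Cor. 3.8 (ii) site: `cor38_ii_of_inputs` with F-2341 / F-2808 / F-1026 / F-0581 supplied by name -/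

namespace Cor38Hyp

variable {D₀ : Type u₀} [Category.{v₀} D₀] {D₀' : Type u₀} [Category.{v₀} D₀']
  {T : RealifiedDivisorMonoids (D₀ := D₀) treeMonoidVocab.{w}}
  {T' : RealifiedDivisorMonoids (D₀ := D₀') treeMonoidVocab.{w}}
  {D : Type u} [Category.{v} D] {D' : Type u} [Category.{v} D']
  {IsRational IsStrictlyRational : (Dᵒᵖ ⥤ CommMonCat.{w}) → Prop}
  {IsRational' IsStrictlyRational' : (D'ᵒᵖ ⥤ CommMonCat.{w}) → Prop}
  {C₁ : TemperedFrobenioid T D (treeCatVocab D IsRational IsStrictlyRational)}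
  {C₂ : TemperedFrobenioid T' D' (treeCatVocab D' IsRational' IsStrictlyRational')} (h : Cor38Hyp C₁ C₂)

/-- **[EtTh] Cor. 3.8 (ii) AS TYPED — abc-iut-w6-d040's knit `cor38_ii_of_inputs` RE-CLOSED at the canonical
vocabularies**: its vocabulary parameter `IsDivSlim (E) (Φ)` := [FrdI] Def. 4.5 (iv) read on `(E, Φ)` (so the bridges
`hvoc_i`, heads F-2341, are `⟨·⟩`); C38-L01 `H` (F-2808) := `standardIsotropicNotGroupLike_treeCatVocab`; [FrdI] Cor. 4.11
(ii) `h411`, `h411'` (F-1026) := `cor411ii_of_fact_treeCatVocab` / `cor411ii_symm_of_fact_treeCatVocab` from [FrdI]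
Thm. 3.4 (ii) (F-0711, PROVED: `FrdI.Thm34ii_holds`); [EtTh] Rmk. 3.6.3 `hR_i` (F-0581) := `remark363_of_isSharp` (the
divisor monoids of a tempered Frobenioid are perf-factorial, hence sharp) from `hP34Λ_i`, `hFinv_i`; its object clause
`hO_i` := `hullEssImageObjClause_holds`; "`C_i` is a Frobenioid" := `isFrobenioid_treeCatVocab_of_isMonoidOn`.  Inputs
left, per side, all named print-level clauses: `hBmon_i`, `hP34Λ_i` (Prop. 3.4 (ii) at monoid type `Λ`), `hFinv_i`
(Prop. 3.4 (ii) iso 3), `hNZ_i` (Def. 3.6 (ii)(b)), `hSup_i` (suprema along `ℝ·Φ₀^cnst`).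
[cite: MochizukiEtTh2009, Cor 3.8 p.81] -/
theorem cor38_ii_of_inputs_reclosed
    (hBmon₁ : IsMonoidOn C₁.ratFnFunctor) (hBmon₂ : IsMonoidOn C₂.ratFnFunctor)
    -- side 1: Prop. 3.4 (ii) at `Λ` (iso 2), iso 3, Def. 3.6 (ii)(b), suprema along the constant line
    (hP34Λ₁ : ∀ (Y : D₀ᵒᵖ) (b : T.BΛ.obj Y) (r : T.ΦR.obj Y),
      T.divΛ Y b = Algebra.GrothendieckGroup.of r → b ∈ T.FΛ Y)
    (hFinv₁ : ∀ (Y : D₀ᵒᵖ) (b : T.BΛ.obj Y), b ∈ T.FΛ Y → ∃ b' ∈ T.FΛ Y, b' * b = 1)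
    (hNZ₁ : ∀ A : Dᵒᵖ, ∃ u : (T.BΛ.obj (C₁.baseOp A) : Type w) × Algebra.GrothendieckGroup (C₁.Φ.carrier A),
      u ∈ C₁.cnstFn A ∧ ∃ Z : C₁.Φ.carrier A, Z ≠ 1 ∧ u.2 = Algebra.GrothendieckGroup.of Z)
    (hSup₁ : ∀ (W : D) (m : Perfection (C₁.divisorMonoid.obj (op W)))
      (U : Set (Perfection (C₁.divisorMonoid.obj (op W)))),
      U ⊆ C₁.bsFldPf W → U.Nonempty → (∀ u ∈ U, u ∣ m) → ∃ y ∈ C₁.bsFldPf W, (∀ u ∈ U, u ∣ y) ∧ y ∣ m)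
    -- side 2
    (hP34Λ₂ : ∀ (Y : D₀'ᵒᵖ) (b : T'.BΛ.obj Y) (r : T'.ΦR.obj Y),
      T'.divΛ Y b = Algebra.GrothendieckGroup.of r → b ∈ T'.FΛ Y)
    (hFinv₂ : ∀ (Y : D₀'ᵒᵖ) (b : T'.BΛ.obj Y), b ∈ T'.FΛ Y → ∃ b' ∈ T'.FΛ Y, b' * b = 1)
    (hNZ₂ : ∀ A : D'ᵒᵖ, ∃ u : (T'.BΛ.obj (C₂.baseOp A) : Type w) × Algebra.GrothendieckGroup (C₂.Φ.carrier A),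
      u ∈ C₂.cnstFn A ∧ ∃ Z : C₂.Φ.carrier A, Z ≠ 1 ∧ u.2 = Algebra.GrothendieckGroup.of Z)
    (hSup₂ : ∀ (W : D') (m : Perfection (C₂.divisorMonoid.obj (op W)))
      (U : Set (Perfection (C₂.divisorMonoid.obj (op W)))),
      U ⊆ C₂.bsFldPf W → U.Nonempty → (∀ u ∈ U, u ∣ m) → ∃ y ∈ C₂.bsFldPf W, (∀ u ∈ U, u ∣ y) ∧ y ∣ m) :
    Literature.AnabelianGeometry.EtaleTheta.Cor38_ii
      (fun E _ Φ => ∀ (A : E) (α : Aut (Over.forget A)),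
        (∀ (B : Over A) (x : Φ.obj (op B.left)),
          Literature.AlgebraicGeometry.Frobenioids.pull Φ (α.hom.app B) x = x) → α = 1) h :=
  h.cor38_ii_of_inputs _ (fun hd => ⟨hd⟩) (fun hd' => ⟨hd'⟩) FrdI.Thm34ii_holds
    (C₁.isFrobenioid_treeCatVocab_of_isMonoidOn hBmon₁) (C₂.isFrobenioid_treeCatVocab_of_isMonoidOn hBmon₂)
    (h.standardIsotropicNotGroupLike_treeCatVocab hBmon₁ hBmon₂)
    (h.cor411ii_of_fact_treeCatVocab FrdI.Thm34ii_holds hBmon₁ hBmon₂)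
    (h.cor411ii_symm_of_fact_treeCatVocab FrdI.Thm34ii_holds hBmon₁ hBmon₂)
    hP34Λ₁ hNZ₁ hSup₁ hP34Λ₂ hNZ₂ hSup₂
    (C₁.remark363_of_isSharp (fun A => (C₁.isPerfFactorial (op A)).isDivisorial.isSharp) hP34Λ₁ hFinv₁)
    (C₂.remark363_of_isSharp (fun A => (C₂.isPerfFactorial (op A)).isDivisorial.isSharp) hP34Λ₂ hFinv₂)
    C₁.hullEssImageObjClause_holds C₂.hullEssImageObjClause_holds

/-- **The same from STRUCTURAL clauses only**: `hBmon_i` ⟸ (`hBinj_i`: pull-backs of `B₀^Λ` injective, [FrdI] Def. 1.1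
(ii); `hFSM_i`: FSM-morphisms of `D_i` are isomorphisms) by abc-iut-L2-t3's `isMonoidOn_ratFnFunctor`, and `hP34Λ_i` ⟸
the typed Prop. 3.4 (ii) structure `T_i.Prop34Cnst cnst_i` (field `mem_FΛ_of_divΛ_eq_of`; the cone node
`EtTh:Prop3.4(ii)` BY NAME, not a FACT-LIST row). [cite: MochizukiEtTh2009, Cor 3.8 p.81] -/
theorem cor38_ii_of_inputs_reclosed_of_structural
    {Dcnst : Type u₁} [Category.{v₁} Dcnst] {cnst : D₀ ⥤ Dcnst}
    {Dcnst' : Type u₁} [Category.{v₁} Dcnst'] {cnst' : D₀' ⥤ Dcnst'}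
    (hBinj₁ : ∀ {Y Y' : D₀ᵒᵖ} (g : Y ⟶ Y'), Function.Injective (T.BΛ.map g).hom)
    (hFSM₁ : ∀ {A B : D} (α : B ⟶ A), IsFSM α → IsIso α)
    (hP₁ : T.Prop34Cnst cnst)
    (hFinv₁ : ∀ (Y : D₀ᵒᵖ) (b : T.BΛ.obj Y), b ∈ T.FΛ Y → ∃ b' ∈ T.FΛ Y, b' * b = 1)
    (hNZ₁ : ∀ A : Dᵒᵖ, ∃ u : (T.BΛ.obj (C₁.baseOp A) : Type w) × Algebra.GrothendieckGroup (C₁.Φ.carrier A),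
      u ∈ C₁.cnstFn A ∧ ∃ Z : C₁.Φ.carrier A, Z ≠ 1 ∧ u.2 = Algebra.GrothendieckGroup.of Z)
    (hSup₁ : ∀ (W : D) (m : Perfection (C₁.divisorMonoid.obj (op W)))
      (U : Set (Perfection (C₁.divisorMonoid.obj (op W)))),
      U ⊆ C₁.bsFldPf W → U.Nonempty → (∀ u ∈ U, u ∣ m) → ∃ y ∈ C₁.bsFldPf W, (∀ u ∈ U, u ∣ y) ∧ y ∣ m)
    (hBinj₂ : ∀ {Y Y' : D₀'ᵒᵖ} (g : Y ⟶ Y'), Function.Injective (T'.BΛ.map g).hom)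
    (hFSM₂ : ∀ {A B : D'} (α : B ⟶ A), IsFSM α → IsIso α)
    (hP₂ : T'.Prop34Cnst cnst')
    (hFinv₂ : ∀ (Y : D₀'ᵒᵖ) (b : T'.BΛ.obj Y), b ∈ T'.FΛ Y → ∃ b' ∈ T'.FΛ Y, b' * b = 1)
    (hNZ₂ : ∀ A : D'ᵒᵖ, ∃ u : (T'.BΛ.obj (C₂.baseOp A) : Type w) × Algebra.GrothendieckGroup (C₂.Φ.carrier A),
      u ∈ C₂.cnstFn A ∧ ∃ Z : C₂.Φ.carrier A, Z ≠ 1 ∧ u.2 = Algebra.GrothendieckGroup.of Z)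
    (hSup₂ : ∀ (W : D') (m : Perfection (C₂.divisorMonoid.obj (op W)))
      (U : Set (Perfection (C₂.divisorMonoid.obj (op W)))),
      U ⊆ C₂.bsFldPf W → U.Nonempty → (∀ u ∈ U, u ∣ m) → ∃ y ∈ C₂.bsFldPf W, (∀ u ∈ U, u ∣ y) ∧ y ∣ m) :
    Literature.AnabelianGeometry.EtaleTheta.Cor38_ii
      (fun E _ Φ => ∀ (A : E) (α : Aut (Over.forget A)),
        (∀ (B : Over A) (x : Φ.obj (op B.left)),
          Literature.AlgebraicGeometry.Frobenioids.pull Φ (α.hom.app B) x = x) → α = 1) h :=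
  h.cor38_ii_of_inputs_reclosed (C₁.isMonoidOn_ratFnFunctor hBinj₁ hFSM₁) (C₂.isMonoidOn_ratFnFunctor hBinj₂ hFSM₂)
    hP₁.mem_FΛ_of_divΛ_eq_of hFinv₁ hNZ₁ hSup₁ hP₂.mem_FΛ_of_divΛ_eq_of hFinv₂ hNZ₂ hSup₂

end Cor38Hyp

end Literature.AnabelianGeometry.EtaleTheta

end
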